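import Literature.NumberTheory.Automorphic.GodementJacquetRankOne
import Literature.NumberTheory.Automorphic.GodementJacquetContinuation
import Literature.NumberTheory.Automorphic.GodementJacquetZetaIntegralsProofs
import Literature.NumberTheory.Automorphic.SatakeParameterBoundHolds
import Literature.NumberTheory.Automorphic.GLOneStandardLTate
import Literature.NumberTheory.Automorphic.GLOneOfHeckeCharacter
import Literature.NumberTheory.Automorphic.GLOneOfHeckeCharacterBJ
import Literature.NumberTheory.Automorphic.AdelicGroupDataGLOneMeasureProofs
import Literature.NumberTheory.Automorphic.PairLFunctionPolesGLOneTateProofs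
import Literature.NumberTheory.GaloisRepresentations.HeckeLFunctionNonvanishingLineProofs
import HarnessLib

/-!
# Meromorphic continuation of Hecke `L`-functions (Tate's theorem): the discharge

Topic `NumberTheory/GaloisRepresentations`; namespace `Literature.NumberTheory.GaloisRepresentations`.
Proof file (theorems only: no definition, no named fact, no instance, no `sorry`) discharging the
named fact `heckeLFunction_hasMeromorphicContinuation` of `HeckeCharacter.lean`:

> J. Tate, *Fourier analysis in number fields and Hecke's zeta-functions* (1950), in
> Cassels–Fröhlich, *Algebraic Number Theory* (1967), Ch. XV, Thm. 4.4.1 (p. 342): the zeta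
> function `ζ(f, c)` of a quasi-character `c` of the idele class group "may be analytically
> continued to the domain of all quasi-characters" — whence (§4.5, the `ζ`-functions as products of
> local factors) `L(s, χ)` is meromorphic on `ℂ` for every (unitary) Hecke character `χ`
> (Hecke (1920); Neukirch, *Algebraic Number Theory*, VII (8.5)).

Nothing here is new analysis: the file **assembles theorems already in the tree**, along the
printed route "Tate's theorem = Godement–Jacquet for `GL_1`" (Godement–Jacquet, LNM 260 (1972),
Thm. 13.8 for `n = 1`; Gelbart (1975), §6.A; Jacquet–Langlands (1970), §9, §12: automorphic forms
on `GL(1)` are idele class characters):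

1. `GodementJacquet1972_gjZeta_meromorphic_one` — the named fact
   `GodementJacquet1972_gjZeta_meromorphic` of `GodementJacquetZetaIntegrals` **holds for `n = 1`**:
   it is the theorem `gjZeta_meromorphic_continuation_fin_one` of `GodementJacquetRankOne` (Poisson
   summation on `𝔸_K`, the reflection identity, the polar terms `E (Φ̂(0)/(s-1) - Φ(0)/s)`), stated
   there for the house Borel structure and here for the arbitrary Borel structure the fact
   quantifies over (all Borel structures on `GL_1(𝔸_K)` coincide, `BorelSpace.measurable_eq`).
2. `partialStandardL_hasMeromorphicContinuation_one` — hence **lang.S21 (partial `L`-functions)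
   holds unconditionally for `GL_1`**: `partialStandardL_hasMeromorphicContinuation (n := 1)`, by the
   proved assembly `partialStandardL_hasMeromorphicContinuation_of_gjZeta_of_summable`
   (`GodementJacquetContinuation`) fed with (1), the Euler factorisation
   `GodementJacquet1972_gjZeta_eulerFactorisation_holds` and Jacquet–Shalika's
   `summable_normSq_trace_satakePow_holds`.
3. `HeckeCharacter.hasMeromorphicContinuation_heckeLFunction_of_map_posRealIdele` — for a unitary
   Hecke character `θ` trivial on `ℝ_{>0}` (`Automorphic.posRealIdele`): `θ = χ_Π` for the cuspidal
   automorphic representation `Π = ℂ · [θ̄ ∘ det]` of `GL_1(𝔸_K)`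
   (`CuspidalAutomorphicRepGL.exists_heckeCharacter_eq`, `GLOneOfHeckeCharacter`), which has a
   non-zero `K(𝔪)`-fixed vector for a level `𝔪 ≠ 0` of `θ` (`HeckeCharacter.exists_level_glOne`) and
   therefore the honest Satake family `v ↦ {θ(ϖ_v)}` off `S = {v ∣ 𝔪}`
   (`GLOne.hasSatakeParameterAt_of_mem_fixedVectors`); by (2) `L^S(s, Π) = ∏_{v ∉ S} (1 - θ(ϖ_v) q_v^{-s})⁻¹`
   (`CuspidalAutomorphicRepGL.partialStandardL_eq_tprod_heckeCharacter`) is meromorphic on `ℂ`, and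
   `L(s, θ)` differs from it on `re s > 1` by the finitely many Euler factors at the unramified
   `v ∈ S` (`Automorphic.heckeLFunction_eq_prod_mul_tprod_compl`), inverses of entire functions.
4. `HeckeCharacter.exists_mul_eq_and_map_posRealIdele_eq_one` — every unitary `χ` is `θ · ‖·‖^{it}`
   with `θ` unitary and trivial on `ℝ_{>0}` (`χ(ρ(r)) = r^{z₀}` with `re z₀ = 0`,
   `HeckeCharacter.exists_cpow_eq_map_posRealIdele`; `‖ρ(r)‖ = r^{[K:ℚ]}`,
   `Automorphic.ideleNorm_posRealIdele_holds`; the characters `‖·‖^z`,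
   `HeckeCharacter.exists_forall_apply_eq_ideleNorm_cpow`), and `L(s, θ ‖·‖^{z}) = L(s + z, θ)`
   (`HeckeCharacter.heckeLFunction_mul_eq_of_forall_apply_eq_cpow`; Tate (1950), §4.4:
   `ζ(f, c|·|^s)`), a translate by a purely imaginary `z`.
5. `heckeLFunction_hasMeromorphicContinuation_holds` — **the named fact is a theorem** for number
   fields `K : Type`.

## Universe

The automorphic formalism of the tree (`AdelicGroupData.gl n K`, `CuspidalAutomorphicRepGL`,
`Automorphic.posRealIdele`, the Godement–Jacquet files) is written for number fields `K : Type`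
(universe `0`), as are all consumers of the named fact in the tree (`ArtinLFunctionsBrauer`,
`PairLFunctionPolesGLOneTateProofs`, `GLOneStandardLTate`, `HeckeLFunctionNonvanishingProofs`, …).
`HeckeCharacter.lean` declares the fact for `K : Type u`; the present discharge is its instance at
`K : Type`, which is the one every consumer instantiates. (The instance at a higher universe
reduces to this one by transporting `K` to `Shrink K : Type` along a ring isomorphism — `K` is
countable — and the adele ring, places and Euler factors with it; that transport is not carried
out here.)

## References

* J. Tate, *Fourier analysis in number fields and Hecke's zeta-functions* (1950), in
  Cassels–Fröhlich (eds.), *Algebraic Number Theory* (1967), Ch. XV, Thm. 4.4.1 (p. 342), §4.5.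
  [TateThesis1967]
* R. Godement, H. Jacquet, *Zeta functions of simple algebras*, LNM 260 (1972), Thm. 13.8.
  [GodementJacquet1972]
* S. Gelbart, *Automorphic forms on adele groups*, Ann. of Math. Stud. 83 (1975), §6.A.
  [Gelbart1975]
* J. Neukirch, *Algebraic Number Theory* (1999), Ch. VII §8, Thm. (8.5) and the remark preceding it.
  [NeukirchANT1999]
-/

noncomputable section

open MeasureTheory Measure NumberField IsDedekindDomain Filter Complex
open scoped MatrixGroups NNReal Topology

/-! ### Godement–Jacquet for `GL_1`: the named facts hold for `n = 1` -/

namespace Literature.NumberTheory.Automorphic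

section RankOne

variable {K : Type} [Field K] [NumberField K]

/-- **`GodementJacquet1972_gjZeta_meromorphic` holds for `n = 1`** (Godement–Jacquet (1972),
Thm. 13.8 for `GL_1` = Tate (1950), Thm. 4.4.1): for every Schwartz–Bruhat `Φ` on `M_1(𝔸_K) = 𝔸_K`,
all `φ, φ' ∈ L²(GL_1(K) ℝ_{>0} \ GL_1(𝔸_K))` and every Haar measure `ν` on `GL_1(𝔸_K)` (for any
Borel structure), the zeta integral `Z(Φ, s, φ, φ')` converges absolutely on a right half-plane and
agrees there with a meromorphic function on `ℂ`. This is `gjZeta_meromorphic_continuation_fin_one`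
of `GodementJacquetRankOne` (which needs neither cuspidality nor `K`-finiteness of `φ, φ'`), after
identifying the quantified Borel structure with the house one (`BorelSpace.measurable_eq`).
[cite: GodementJacquet1972, Thm. 13.8] -/
theorem GodementJacquet1972_gjZeta_meromorphic_one
    (μ : Measure (AdelicGroupData.gl 1 K).automorphicQuotient)
    [(AdelicGroupData.gl 1 K).IsAutomorphicMeasure μ] :
    GodementJacquet1972_gjZeta_meromorphic (n := 1) (K := K) (μ := μ) := by
  intro P Φ hΦ φ φ' _ _ _ _ mG hB ν hν
  have hmG : mG = borel _ := BorelSpace.measurable_eq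
  subst hmG
  obtain ⟨x₀, hint, g, hg, hgZ⟩ :=
    @gjZeta_meromorphic_continuation_fin_one K _ _ μ _ Φ hΦ φ φ' ν hν
  exact ⟨x₀, hint, g, hg, fun h => absurd h (by norm_num), hgZ⟩

/-- **lang.S21 (partial `L`-functions) holds unconditionally for `GL_1`**: for every cuspidal
automorphic representation `Π` of `GL_1(𝔸_K)`, every finite `S ⊇` ramified places and every honest
Satake family `α` of `Π` off `S`, `L^S(s, Π)` has meromorphic continuation to `ℂ` — the assembly
`partialStandardL_hasMeromorphicContinuation_of_gjZeta_of_summable` (`GodementJacquetContinuation`)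
fed with `GodementJacquet1972_gjZeta_meromorphic_one`, the Euler factorisation
`GodementJacquet1972_gjZeta_eulerFactorisation_holds` and Jacquet–Shalika's
`summable_normSq_trace_satakePow_holds`. [cite: GodementJacquet1972, Thm. 13.8] -/
theorem partialStandardL_hasMeromorphicContinuation_one
    (μ : Measure (AdelicGroupData.gl 1 K).automorphicQuotient)
    [(AdelicGroupData.gl 1 K).IsAutomorphicMeasure μ] :
    partialStandardL_hasMeromorphicContinuation (n := 1) (K := K) (μ := μ) :=
  partialStandardL_hasMeromorphicContinuation_of_gjZeta_of_summable
    (GodementJacquet1972_gjZeta_meromorphic_one μ) GodementJacquet1972_gjZeta_eulerFactorisation_holds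
    summable_normSq_trace_satakePow_holds

end RankOne

end Literature.NumberTheory.Automorphic

/-! ### Hecke characters trivial on `ℝ_{>0}`: Tate's theorem through the Hecke–Tate dictionary -/

namespace Literature.NumberTheory.GaloisRepresentations

namespace HeckeCharacter

open Literature.NumberTheory.Automorphic AdelicGroupData

variable {K : Type} [Field K] [NumberField K]

/-- **Honest Satake data of a Hecke character trivial on `ℝ_{>0}`.** For `θ` unitary with
`θ(ρ(ℝ_{>0})) = 1` there are a cuspidal automorphic representation `Π` of `GL_1(𝔸_K)` with
`χ_Π = θ` (the line `ℂ · [θ̄ ∘ det]`, `CuspidalAutomorphicRepGL.exists_heckeCharacter_eq`) and a finite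
set `S` of finite places (the prime divisors of a level `𝔪 ≠ 0` of `θ`,
`HeckeCharacter.exists_level_glOne`) such that `v ↦ {θ(ϖ_v)}` is an honest Satake family of `Π` off
`S` (`GLOne.hasSatakeParameterAt_of_mem_fixedVectors`: a non-zero `K(𝔪)`-fixed vector is a Hecke
eigenvector at every `v ∤ 𝔪` with parameter `{χ_Π(ϖ_v)}`). Gelbart (1975), §6.A; Jacquet–Langlands
(1970), §9, §12. [cite: Gelbart1975, §6.A (p. 99)] -/
theorem exists_cuspidal_isSatakeFamilyOf_of_map_posRealIdele
    {μ : Measure (gl 1 K).automorphicQuotient} [(gl 1 K).IsAutomorphicMeasure μ]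
    {θ : HeckeCharacter K} (hθ : θ.IsUnitary) (hθ₀ : ∀ t, θ (posRealIdele K t) = 1) :
    ∃ (P : CuspidalAutomorphicRepGL 1 K μ) (S : Finset (HeightOneSpectrum (𝓞 K))),
      P.heckeCharacter = θ ∧
        IsSatakeFamilyOf P (↑S : Set (HeightOneSpectrum (𝓞 K))) fun v => {θ.valueAtUniformizer v} := by
  obtain ⟨P, hPθ, hfix⟩ := CuspidalAutomorphicRepGL.exists_heckeCharacter_eq (μ := μ) θ hθ hθ₀
  obtain ⟨𝔪, h𝔪, hlev⟩ := θ.exists_level_glOne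
  obtain ⟨f, hf, hf0⟩ := hfix (principalCongruenceLevel 1 K 𝔪) fun k hk => by
    have h := hlev k hk
    rwa [detTwist_apply] at h
  refine ⟨P, (Ideal.finite_factors h𝔪).toFinset, hPθ, fun v hv => ?_⟩
  have hv' : ¬ v.asIdeal ∣ 𝔪 := fun h => hv (by simpa using h)
  refine ⟨𝔪, h𝔪, hv', uniformizer K v, ?_⟩
  subst hPθ
  exact GLOne.hasSatakeParameterAt_of_mem_fixedVectors P.isTopIrreducible hf hf0 v
    (valued_uniformizer v)

/-- **Tate's theorem for characters trivial on `ℝ_{>0}`** (Tate (1950), Thm. 4.4.1, through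
Godement–Jacquet for `GL_1`): for a unitary Hecke character `θ` of `K` with `θ(ρ(ℝ_{>0})) = 1`, the
Hecke `L`-function `L(s, θ)` has meromorphic continuation to `ℂ`. With `Π`, `S` as in
`exists_cuspidal_isSatakeFamilyOf_of_map_posRealIdele` (for an automorphic measure on
`GL_1(K) ℝ_{>0} \ GL_1(𝔸_K)`, `exists_isAutomorphicMeasure_gl_one`), lang.S21 for `GL_1`
(`partialStandardL_hasMeromorphicContinuation_one`) continues
`L^S(s, Π) = ∏_{v ∉ S} (1 - θ(ϖ_v) q_v^{-s})⁻¹` (`partialStandardL_eq_tprod_heckeCharacter`) to a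
meromorphic `g₀`; on `re s > 1`, `L(s, θ) = (∏_{v ∈ S} (1 - c_v q_v^{-s}))⁻¹ · L^S(s, Π)` with
`c_v = θ(ϖ_v)` or `0` (`heckeLFunction_eq_prod_mul_tprod_compl`; Neukirch VII §8, remark before
(8.5)), and the finite product is entire, so `g₀ / ∏_{v ∈ S} (1 - c_v q_v^{-s})` is the required
meromorphic function. [cite: TateThesis1967, Thm. 4.4.1] -/
theorem hasMeromorphicContinuation_heckeLFunction_of_map_posRealIdele
    {θ : HeckeCharacter K} (hθ : θ.IsUnitary) (hθ₀ : ∀ t, θ (posRealIdele K t) = 1) :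
    LFunction.HasMeromorphicContinuation (heckeLFunction θ) := by
  classical
  obtain ⟨μ, hμ⟩ := exists_isAutomorphicMeasure_gl_one K
  obtain ⟨P, S, hPθ, hα⟩ := exists_cuspidal_isSatakeFamilyOf_of_map_posRealIdele (μ := μ) hθ hθ₀
  have hS : ∀ v, Automorphic.IsUnramifiedAt P.1 v ∨ v ∈ S := fun v => by
    by_cases hv : v ∈ S
    · exact Or.inr hv
    · exact Or.inl (hα.isUnramifiedAt fun h => hv (Finset.mem_coe.mp h))
  obtain ⟨g₀, hg₀, hg₀L⟩ := partialStandardL_hasMeromorphicContinuation_one μ P S _ hα hS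
  have hur : ∀ v ∉ (S : Set (HeightOneSpectrum (𝓞 K))), θ.IsUnramifiedAt v := fun v hv => by
    rw [← hPθ]
    exact hα.isUnramifiedAt_heckeCharacter hv
  -- the finitely many Euler factors at `S`: an entire function `M`
  have hMd : Differentiable ℂ fun s : ℂ => ∏ v ∈ S,
      (1 - (if θ.IsUnramifiedAt v then θ.valueAtUniformizer v else 0) *
        ((Ideal.absNorm v.asIdeal : ℕ) : ℂ) ^ (-s)) := by
    refine Differentiable.fun_finsetProd fun v _ => ?_
    refine (differentiable_const _).sub ((differentiable_const _).mul ?_)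
    exact differentiable_id.neg.const_cpow
      (Or.inl (Nat.cast_ne_zero.mpr (LFunctions.absNorm_heightOneSpectrum_pos v).ne'))
  refine Automorphic.LFunction.hasMeromorphicContinuation_of_eventually_eq
    (g := fun s => g₀ s * (∏ v ∈ S,
      (1 - (if θ.IsUnramifiedAt v then θ.valueAtUniformizer v else 0) *
        ((Ideal.absNorm v.asIdeal : ℕ) : ℂ) ^ (-s)))⁻¹)
    (hg₀.fun_mul fun x => (hMd.analyticAt x).meromorphicAt.inv) fun x => ?_
  refine Filter.Eventually.of_forall fun s hs => ?_
  have hT : g₀ s = ∏' v : {v : HeightOneSpectrum (𝓞 K) // v ∉ (S : Set (HeightOneSpectrum (𝓞 K)))},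
      (1 - θ.valueAtUniformizer v.1 * ((Ideal.absNorm v.1.asIdeal : ℕ) : ℂ) ^ (-s))⁻¹ := by
    rw [hg₀L s hs, CuspidalAutomorphicRepGL.partialStandardL_eq_tprod_heckeCharacter hα s, hPθ]
    rfl
  rw [heckeLFunction_eq_prod_mul_tprod_compl hθ S hur hs, hT, ← Finset.prod_inv_distrib, mul_comm]

/-- Powers of a positive real number: `((r ^ d : ℝ) : ℂ) ^ z = (r : ℂ) ^ (d z)` (no branch issue:
`log r` is real). [folklore] -/
private theorem ofReal_pow_cpow {r : ℝ} (hr : 0 < r) (d : ℕ) (z : ℂ) :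
    (((r ^ d : ℝ)) : ℂ) ^ z = (r : ℂ) ^ ((d : ℂ) * z) := by
  have him : (Complex.log r * d).im = 0 := by
    rw [← Complex.ofReal_log hr.le, ← Complex.ofReal_natCast, ← Complex.ofReal_mul,
      Complex.ofReal_im]
  rw [Complex.cpow_mul _ (by rw [him]; exact neg_lt_zero.mpr Real.pi_pos)
      (by rw [him]; exact Real.pi_pos.le), Complex.cpow_natCast, Complex.ofReal_pow]

/-- **Every unitary Hecke character is a unitary norm twist of one trivial on `ℝ_{>0}`**:
`χ = θ · ν` with `θ` unitary, `θ(ρ(ℝ_{>0})) = 1`, and `ν = ‖·‖^z` with `re z = 0`. Indeed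
`χ(ρ(r)) = r^{z₀}` for some `z₀` (`exists_cpow_eq_map_posRealIdele`) with `re z₀ = 0` (unitarity at
`r = 2`), `‖ρ(r)‖ = r^{[K:ℚ]}` (`Automorphic.ideleNorm_posRealIdele_holds`), so `ν = ‖·‖^{z₀/[K:ℚ]}`
(`exists_forall_apply_eq_ideleNorm_cpow`) agrees with `χ` on `ρ(ℝ_{>0})` and `θ = χ ν⁻¹` does it.
Tate (1950), §4.3 (`c = c̃ |·|^s`, `𝕀_K = ℝ_{>0} × J`); Iwasawa (1964), §1. [cite: TateThesis1967, §4.3] -/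
theorem exists_mul_eq_and_map_posRealIdele_eq_one {χ : HeckeCharacter K} (hχ : χ.IsUnitary) :
    ∃ (θ ν : HeckeCharacter K) (z : ℂ), θ.IsUnitary ∧ (∀ t, θ (posRealIdele K t) = 1) ∧ z.re = 0 ∧
      (∀ x : ideleGroup K, ((ν x : ℂˣ) : ℂ) = ((ideleNorm x : ℝ) : ℂ) ^ z) ∧ χ = θ * ν := by
  obtain ⟨z₀, hz₀⟩ := exists_cpow_eq_map_posRealIdele χ
  -- `re z₀ = 0`: `|χ(ρ(2))| = 2 ^ re z₀ = 1`
  have hre : z₀.re = 0 := by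
    have h1 := hχ (posRealIdele K (Units.mk0 2 two_ne_zero))
    rw [hz₀, Units.val_mk0, NNReal.coe_ofNat, Complex.norm_cpow_eq_rpow_re_of_pos two_pos] at h1
    have h2 := congrArg Real.log h1
    rw [Real.log_rpow two_pos, Real.log_one] at h2
    exact (mul_eq_zero.mp h2).resolve_right (Real.log_pos one_lt_two).ne'
  set d : ℕ := Module.finrank ℚ K with hd
  have hd0 : (d : ℂ) ≠ 0 := Nat.cast_ne_zero.mpr Module.finrank_pos.ne'
  obtain ⟨ν, hν⟩ := exists_forall_apply_eq_ideleNorm_cpow K (z₀ / d)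
  have hνρ : ∀ t : ℝ≥0ˣ, ((ν (posRealIdele K t) : ℂˣ) : ℂ) = ((((t : ℝ≥0) : ℝ)) : ℂ) ^ z₀ := by
    intro t
    have ht : (0 : ℝ) < ((t : ℝ≥0) : ℝ) := NNReal.coe_pos.mpr (pos_iff_ne_zero.mpr t.ne_zero)
    rw [hν, ← Automorphic.coe_ideleNorm, Automorphic.ideleNorm_posRealIdele_holds, NNReal.coe_pow,
      ofReal_pow_cpow ht, mul_div_cancel₀ _ hd0]
  refine ⟨χ * ν⁻¹, ν, z₀ / d, hχ.mul (isUnitary_of_forall_apply_eq_cpow hν ?_).inv, fun t => ?_,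
    ?_, hν, (inv_mul_cancel_right χ ν).symm⟩
  · rw [Complex.div_natCast_re, hre, zero_div]
  · refine Units.val_eq_one.mp ?_
    have ht : (0 : ℝ) < ((t : ℝ≥0) : ℝ) := NNReal.coe_pos.mpr (pos_iff_ne_zero.mpr t.ne_zero)
    have hne : ((((t : ℝ≥0) : ℝ)) : ℂ) ^ z₀ ≠ 0 := fun h => by
      rw [Complex.cpow_eq_zero_iff] at h
      exact (Complex.ofReal_ne_zero.mpr ht.ne') h.1
    rw [mul_apply, Units.val_mul, inv_apply, Units.val_inv_eq_inv_val, hz₀, hνρ,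
      mul_inv_cancel₀ hne]
  · rw [Complex.div_natCast_re, hre, zero_div]

end HeckeCharacter

/-! ### The named fact -/

variable {K : Type} [Field K] [NumberField K]

open Literature.NumberTheory.Automorphic in
/-- **Tate's theorem: Hecke `L`-functions have meromorphic continuation** — the named fact
`heckeLFunction_hasMeromorphicContinuation χ` of `HeckeCharacter.lean` (Tate (1950), Thm. 4.4.1;
Hecke (1920); Neukirch VII (8.5)) is a theorem for every Hecke character `χ` of every number field
`K : Type`. For unitary `χ = θ · ‖·‖^z` (`HeckeCharacter.exists_mul_eq_and_map_posRealIdele_eq_one`,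
`re z = 0`) one has `L(s, χ) = L(s + z, θ)`
(`HeckeCharacter.heckeLFunction_mul_eq_of_forall_apply_eq_cpow`), and `L(·, θ)` is meromorphic on
`ℂ` (`HeckeCharacter.hasMeromorphicContinuation_heckeLFunction_of_map_posRealIdele`); the translate
`s ↦ g(s + z)` of its continuation is meromorphic (`MeromorphicAt.comp_analyticAt`) and agrees with
`L(s, χ)` on `re s > 1 ⇔ re (s + z) > 1`. [cite: TateThesis1967, Thm. 4.4.1] -/
theorem heckeLFunction_hasMeromorphicContinuation_holds (χ : HeckeCharacter K) :
    heckeLFunction_hasMeromorphicContinuation χ := by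
  intro hχ
  obtain ⟨θ, ν, z, hθ, hθ₀, hz, hν, rfl⟩ :=
    HeckeCharacter.exists_mul_eq_and_map_posRealIdele_eq_one hχ
  obtain ⟨g, hg, hgL⟩ :=
    HeckeCharacter.hasMeromorphicContinuation_heckeLFunction_of_map_posRealIdele hθ hθ₀
  refine ⟨fun s => g (s + z), fun x => ?_, fun s hs => ?_⟩
  · have ha : AnalyticAt ℂ (fun s : ℂ => s + z) x := analyticAt_id.add analyticAt_const
    exact MeromorphicAt.comp_analyticAt (g := fun s : ℂ => s + z) (x := x) (hg (x + z)) ha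
  · show g (s + z) = heckeLFunction (θ * ν) s
    rw [HeckeCharacter.heckeLFunction_mul_eq_of_forall_apply_eq_cpow θ hν s, hgL (s + z)]
    rw [Complex.add_re, hz, add_zero]
    exact hs

end Literature.NumberTheory.GaloisRepresentations
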